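import Summits.BirchSwinnertonDyer.BirchSwinnertonDyer.Theorems.EisensteinPrimesCharGrSelmerCorankGeOfFacts
import Summits.BirchSwinnertonDyer.BirchSwinnertonDyer.Theorems.EisensteinPrimesAcTwistDeformationLocSurjOfSurC
import Literature.NumberTheory.GaloisCohomology.TateGlobalEulerCharacteristicTotallyComplex
import HarnessLib

/-!
# Crux 4 `BSDpOnCellC` (stmt-BirchSwinnertonDyer-19034) — «OfSurC» re-typing, file 4: CGLS Prop. 1.2.5's CORANK CLAUSE
# `prop125_characterGrSelmerDual_corank_ge` from Greenberg 2016 Prop. 2.6.3 CASE (c) AT TOTALLY COMPLEX FIELDS BY NAME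
# (`prop263_sur_of_crk_caseC_tc`) instead of the full Prop. 2.6.3 (`prop263_sur_of_crk`)

Cell `bsd-eis` (run/shared/lean/pub/bsd-eis/), width seat `bsd-line-x2-p2` gen 16; `--supports stmt-BirchSwinnertonDyer-19034`
(helper; closes nothing; skeleton of record crystal v10 UNCHANGED, W-79). Sequel of `…SplitMultLambdaLEOfSurC` /
`…SplitMultCharImprimitiveShiftOfSurC` (module docstring of the former: why crux 4's consumers of `prop263_sur_of_crk` are re-typed
onto the case-(c)-TC statement read by crux 2 and by road «SUR-Λ»).

WHAT. `CharGrSelmerCorankGeOfFacts.prop125_characterGrSelmerDual_corank_ge_of_facts` (x2-p2 g9: CGLS Prop. 1.2.5's corank inequality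
`Σ_{w∈S} λ(𝒫_w(θ)) ≤ corank_{ℤ_p}(H¹_{𝓕_Gr^S}/H¹_{𝓕_Gr})` for a `p`-distinguished character with `θ|_{G_v̄} ≠ 𝟙, ω`, as the NAMED
statement `prop125_characterGrSelmerDual_corank_ge`, from Greenberg's facts + CGLS 1.2.5's module clause) re-typed:
`(h263 : prop263_sur_of_crk_caseC_tc)`; road-(A) leaf = x1-w5's `AcTwistDeformation.exists_mem_unrSelmer_forall_resOfLe_conjH1_eq_ofSurC`,
whose Tate-TC-shaped `h32` is the tree theorem `GaloisCohomology.forall_tateGlobalEulerPoincareCharacteristic_of_isTotallyComplex` (fed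
inside), so the binder `(h32 : prop32_cohomology_isCofinitelyGenerated)` is DROPPED; everything else VERBATIM.  Because the conclusion
is a NAMED statement, the whole NON-SPLIT half of crux 4's wall (g8's `StrictEqUnramifiedCentral.…_of_facts`, `…NonsplitOfFactsUnr`,
which take `hge : prop125_characterGrSelmerDual_corank_ge`) needs no further twin: the sequel `…ImprimitiveCountNonsplitOfGe` takes `hge`.

HONEST FRAMING: theorems only (0 defs, 0 named facts, 0 sorry, 0 instances); CONDITIONAL on the published named facts carried as
hypotheses; closes no stub; no summit statement / BSD / MC / IMC is proved for any curve; 0 cells / labels / tiers move.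

References: [CastellaGrossiLeeSkinner2022] §1.2 Prop. 1.2.5 and proof (eq:sur1)–(eq:sur2), Lemma 1.1.1, Thm. 1.2.2; [PollackWeston2011]
App. A Prop. A.2; [Greenberg2016Selmer] Prop. 2.6.3 (c); [Greenberg2010] Prop. 3.2.1 (c); [MilneADT2006] I Thm. 5.1; [Greenberg2006]
Props. 4.1, 4.2, §5 A; [Brink2007] Thm. 2, Cor. 1; [KellerYin2024] Prop. 1.2.5, Rem. 1.2.3; [GreenbergVatsal2000] §2 Cor. (2.3), Prop. (2.4).
-/

set_option autoImplicit false
set_option linter.dupNamespace false -- the summit namespace `…BirchSwinnertonDyer.BirchSwinnertonDyer.Theorems` (Sub = Summit, D-0017) trips it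

noncomputable section

open scoped Classical AddSubgroup
open NumberField IsDedekindDomain Field Multiplicative PowerSeries
open Literature.NumberTheory.EllipticCurves Literature.NumberTheory.EllipticCurves.GreenbergSelmer
  Literature.NumberTheory.EllipticCurves.GreenbergVatsal2000 Literature.NumberTheory.GaloisRepresentations
  Literature.NumberTheory.EllipticCurves.KellerYin2024 Literature.NumberTheory.EllipticCurves.IwasawaDual
  Literature.NumberTheory.EllipticCurves.CastellaGrossiLeeSkinner2022
  Literature.NumberTheory.IwasawaTheory Literature.NumberTheory.IwasawaTheory.Greenberg2016
  Literature.NumberTheory.IwasawaTheory.Greenberg2006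
  Summit.BirchSwinnertonDyer.BirchSwinnertonDyer.Theorems
  Summit.BirchSwinnertonDyer.BirchSwinnertonDyer.Theorems.AcTwistDeformation
  Summit.BirchSwinnertonDyer.BirchSwinnertonDyer.Theorems.AcTwistDeformationResidualPair

namespace Summit.BirchSwinnertonDyer.BirchSwinnertonDyer.Theorems.CharGrSelmerCorankGeOfFacts

/-- **[«OfSurC» re-typing: Greenberg 2016 Prop. 2.6.3 by name ↦ its case (c) at totally complex `K` by name (`prop263_sur_of_crk_caseC_tc`);
binder `h32` dropped (Prop. 3.2 enters only as Tate's global EPC at totally complex fields, a tree theorem fed inside).]**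
**CGLS Prop. 1.2.5's corank clause `prop125_characterGrSelmerDual_corank_ge` FROM Greenberg 2016 Prop. 2.6.3 (c) at totally complex `K`,
Greenberg 2006 Props. 4.1 / 4.2 / §5 A and CGLS Prop. 1.2.5's module clause, BY NAME** — `prop125_characterGrSelmerDual_corank_ge_of_facts`
otherwise VERBATIM (the one-variable twist deformation `𝐃₁(θ)` over `K_Σ/K`, SUR(𝐃₁(θ), 𝓛_v) in case (c), Shapiro, Lemma 1.1.1 corank
bookkeeping, g8's strict = unramified bridge).
[cite: CastellaGrossiLeeSkinner2022, §1.2 Prop. 1.2.5 `propchar` and proof (eq:sur1)–(eq:sur2), Lemma 1.1.1, Thm. 1.2.2 (arXiv:2008.02571 Prop. 14, Lemma 9, Thm. 11; Invent. Math. 227 (2022) 517–580)]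
[cite: PollackWeston2011, App. A Prop. A.2] [cite: Greenberg2016Selmer, Prop. 2.6.3 (c) (§2.6 p. 10)] [cite: Greenberg2010, Prop. 3.2.1 (c) (p. 15)]
[cite: MilneADT2006, I Thm. 5.1 (p. 67)] [cite: Greenberg2006, Props. 4.1, 4.2, §5 A] [cite: Brink2007, Thm. 2 and Cor. 1]
[cite: GreenbergVatsal2000, §2 Cor. (2.3), Prop. (2.4) (pp. 20–23)] [cite: KellerYin2024, Prop. 1.2.5, Rem. 1.2.3 (arXiv:2402.12781v2 TeX L780–800)] -/
theorem prop125_characterGrSelmerDual_corank_ge_of_facts_ofSurC (h263 : prop263_sur_of_crk_caseC_tc)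
    (h41 : prop41_globalEulerPoincareCorank) (h42 : prop42_localEulerPoincareCorank)
    (h5A : sec5A_localH2_subsingleton_of_LOC1)
    (hprop125 : prop125_characterGrSelmerDual_torsion_muZero_dim) :
    prop125_characterGrSelmerDual_corank_ge := by
  intro K _ _ p _ hK hp2 hsplit κ hκ 𝔭 h𝔭 θ hθ S hSmem hunr hne1 hneω
  have hp : 2 < p := lt_of_le_of_ne (Fact.out : p.Prime).two_le (Ne.symm hp2)
  have hT : ∀ (L : Type) [Field L] [NumberField L] [IsTotallyComplex L],
      Literature.NumberTheory.GaloisCohomology.tateGlobalEulerPoincareCharacteristic L :=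
    Literature.NumberTheory.GaloisCohomology.forall_tateGlobalEulerPoincareCharacteristic_of_isTotallyComplex
  obtain ⟨γ, hγ⟩ : ∃ γ : absoluteGaloisGroup K, κ.IsTopGenerator γ := κ.surjective (Multiplicative.ofAdd 1)
  -- the partner prime `v ∣ p`, `v ≠ 𝔭 = v̄`
  obtain ⟨v, hv, hne⟩ := exists_other_prime_of_ncard_primesOver_eq_two (p := p) hsplit 𝔭 h𝔭
  have hSp : ∀ w : HeightOneSpectrum (𝓞 K), ((p : ℕ) : 𝓞 K) ∈ w.asIdeal → w = v ∨ w = 𝔭 :=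
    fun w hw ↦ GreenbergFullAtSelmer.eq_or_eq_of_natCast_mem_of_ne hK.1 hv h𝔭 hne hw
  have hSfp : ∀ w ∈ S, ((p : ℕ) : 𝓞 K) ∉ w.asIdeal := fun w hw ↦ (hSmem w hw).1
  -- every `w ∈ S` is finitely decomposed in `K_∞` (Brink), with `κ(D_w) = p^{a_w} ℤ_p` exactly
  have hdec : ∀ w ∈ S, ∃ δ ∈ decomp (K := K) w, κ δ ≠ 1 := fun w hw ↦
    exists_mem_decomp_apply_ne_one_of_ncard_primesOver_under hK hp2 κ hκ w (hSmem w hw).1 (hSmem w hw).2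
  have hdec' : ∀ w ∈ S, ¬ decomp (K := K) w ≤ κ.kerSubgroup := fun w hw hle ↦ by
    obtain ⟨δ, hδ, hne1⟩ := hdec w hw
    exact hne1 (ZpExtension.mem_kerSubgroup.mp (hle hδ))
  have hexp : ∀ w : HeightOneSpectrum (𝓞 K), ∃ a : ℕ, w ∈ S →
      (∃ δ ∈ decomp (K := K) w, (κ δ).toAdd = (p : ℤ_[p]) ^ a) ∧
        ∀ δ ∈ decomp (K := K) w, (p : ℤ_[p]) ^ a ∣ (κ δ).toAdd := by
    intro w
    by_cases hw : w ∈ S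
    · obtain ⟨c, ⟨d₀, hd₀⟩, -, hdvd⟩ :=
        UniversalToricDescentSigmaLocalStabilizer.exists_pow_and_forall_dvd_of_not_le κ w (hdec' w hw)
      exact ⟨c, fun _ ↦ ⟨⟨d₀, d₀.2, hd₀⟩, fun δ hδ ↦ hdvd ⟨δ, hδ⟩⟩⟩
    · exact ⟨0, fun h ↦ (hw h).elim⟩
  choose a ha using hexp
  have hd₀ : ∀ w ∈ S, ∃ δ ∈ decomp (K := K) w, (κ δ).toAdd = (p : ℤ_[p]) ^ a w :=
    fun w hw ↦ (ha w hw).1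
  have hdiv : ∀ w ∈ S, ∀ δ ∈ decomp (K := K) w, (p : ℤ_[p]) ^ a w ∣ (κ δ).toAdd :=
    fun w hw ↦ (ha w hw).2
  -- the representatives `γ^i` of the places above `w`: `κ(γ^i) = i`
  have hσrep : ∀ w ∈ S, ∀ i : ℕ, i < p ^ a w → (κ ((fun (_ : HeightOneSpectrum (𝓞 K)) (i : ℕ) ↦ γ ^ i) w i)).toAdd =
      (i : ℤ_[p]) := fun w _ i _ ↦ by
    change (κ (γ ^ i)).toAdd = (i : ℤ_[p])
    rw [map_pow, show κ γ = Multiplicative.ofAdd 1 from hγ, ← ofAdd_nsmul, toAdd_ofAdd, nsmul_one]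
  -- `Σ = {v, v̄} ∪ S`; `θ` is unramified outside `Σ`
  have hS : ∀ w : HeightOneSpectrum (𝓞 K), ((p : ℕ) : 𝓞 K) ∈ w.asIdeal →
      w ∈ (↑(insert v (insert 𝔭 S)) : Set (HeightOneSpectrum (𝓞 K))) :=
    mem_insert_insert_of_natCast_mem hK hv h𝔭 hne S
  have hSfS : ∀ w ∈ S, w ∈ (↑(insert v (insert 𝔭 S)) : Set (HeightOneSpectrum (𝓞 K))) := fun w hw ↦ by
    rw [Finset.coe_insert, Finset.coe_insert]
    exact Or.inr (Or.inr (Finset.mem_coe.mpr hw))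
  have h : ramificationSubgroup K (↑(insert v (insert 𝔭 S)) : Set (HeightOneSpectrum (𝓞 K))) ≤
      (unitChar θ).toMonoidHom.ker :=
    ramificationSubgroup_le_ker_unitChar_of_forall_inertia θ hθ _ fun w hw ↦
      hunr w (fun hwS ↦ hw (hSfS w hwS)) (fun hwp ↦ hw (hS w hwp))
  -- the `σ`-supply at every place of `Σ`
  have hsup : ∀ w ∈ (↑(insert v (insert 𝔭 S)) : Set (HeightOneSpectrum (𝓞 K))),
      ∃ σ : absoluteGaloisGroup (Place.Completion (Sum.inr w : Place K)), κ (absGaloisRestrict K _ σ) ≠ 1 := by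
    intro w hw
    rw [Finset.coe_insert, Finset.coe_insert] at hw
    rcases hw with rfl | rfl | hw
    · exact exists_local_apply_ne_one_of_natCast_mem hK κ hv
    · exact exists_local_apply_ne_one_of_natCast_mem hK κ h𝔭
    · exact exists_local_apply_ne_one_of_exists_mem_decomp κ (hdec w (Finset.mem_coe.mp hw))
  -- the canonical (discrete) topological instances of the model
  letI tΛ : TopologicalSpace (PowerSeries ℤ_[p]) := ⊥
  haveI : DiscreteTopology (PowerSeries ℤ_[p]) := ⟨rfl⟩
  haveI : IsTopologicalRing (PowerSeries ℤ_[p]) := inferInstance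
  haveI hAdisc : DiscreteTopology (QpModZp p) := QpModZp.discreteTopology p
  haveI : IsTopologicalAddGroup (BigRepModule ℤ_[p] p (QpModZp p)) := inferInstance
  haveI : ContinuousSMul (PowerSeries ℤ_[p]) (BigRepModule ℤ_[p] p (QpModZp p)) := inferInstance
  -- the model `ρ_θ` on `ℚ_p/ℤ_p`, `ψ = (charModuleEquiv θ)⁻¹`, the Shapiro descent `F`, and [RH] (§2)
  have hψ := charModuleEquiv_symm_galois (↑(insert v (insert 𝔭 S)) : Set (HeightOneSpectrum (𝓞 K))) θ h
  obtain ⟨F, hF⟩ := exists_shapiroDescent _ hS κ (characterRepUnramified _ θ h) (charModuleEquiv θ).symm hψ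
  obtain ⟨D⟩ := nonempty_unrDualData_char (∅ : Set (PadicAlgCl p)) θ κ 𝔭 (∅ : Set (HeightOneSpectrum (𝓞 K))) hγ
  obtain ⟨hDfin, hDtor⟩ := unrDual_moduleFinite_isTorsion_of_fact hprop125 hK hp2 hsplit κ hκ hγ 𝔭 h𝔭 θ hθ S hSmem
    hunr hne1 hneω D
  obtain ⟨hSel, hSelfg⟩ := hasCorank_fullAtSelmer_zero_of_datumDualData _ hS κ (characterRepUnramified _ θ h)
    (charModuleEquiv θ).symm hψ (QpModZp.exists_pow_nsmul_eq_zero (p := p))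
    (exists_pow_smul_cofree_eq_zero (∅ : Set (PadicAlgCl p)) θ) (isOpen_stabilizer_cofree (∅ : Set (PadicAlgCl p)) θ)
    hγ hv hne hSp D hDfin hDtor
  -- the `K_∞`-side global-to-local surjectivity (road (A), file 8)
  have h8 : ∀ y : ∀ w : HeightOneSpectrum (𝓞 K), ℕ →
      subgroupH1 (κ.kerSubgroup ⊓ decomp (K := K) w) (charModule (∅ : Set (PadicAlgCl p)) θ),
      ∃ u ∈ unrSelmer κ (charModule (∅ : Set (PadicAlgCl p)) θ) 𝔭 (↑S : Set (HeightOneSpectrum (𝓞 K))),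
        ∀ w ∈ S, ∀ i : ℕ, i < p ^ a w →
          resOfLe (charModule (∅ : Set (PadicAlgCl p)) θ)
            (inf_le_left : κ.kerSubgroup ⊓ decomp (K := K) w ≤ κ.kerSubgroup)
            (conjH1 κ.kerSubgroup (charModule (∅ : Set (PadicAlgCl p)) θ) (γ ^ i) u) = y w i := fun y ↦
    exists_mem_unrSelmer_forall_resOfLe_conjH1_eq_ofSurC _ hS κ (characterRepUnramified _ θ h)
      (charModuleEquiv θ).symm hψ h263 h41 h42 h5A hT (Finset.finite_toSet _) hK
      (LinearEquiv.refl ℤ_[p] (QpModZp p)) (characterRepUnramified_hscalar _ θ h) hsup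
      hne hv h𝔭 hSp hSel hSelfg (fun b ↦ QpModZp.exists_pow_nsmul_eq_zero b) hF S hSfS hSfp a hdiv hd₀
      (fun _ i ↦ γ ^ i) hσrep y
  -- corank bookkeeping: the `𝓕_nr` inequality
  have hunrineq := UnrSelmerLocSurjAdapter.sum_charLocalLambda_le_zpCorank_unrSelmer_quotient_of_forall_exists κ θ 𝔭 S
    hθ hγ hSfp hdec a hdiv hd₀ (fun _ i ↦ γ ^ i) hσrep h8
  -- g8's bridge at `S` and at `∅`: the `𝓕_Gr` inequality
  rw [zpCorank_quotient_congr
    (StrictEqUnramifiedCentral.grSelmer_charModule_eq_unrSelmer κ 𝔭 (↑S : Set (HeightOneSpectrum (𝓞 K))) θ hθ hne1)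
    (StrictEqUnramifiedCentral.grSelmer_charModule_eq_unrSelmer κ 𝔭 (∅ : Set (HeightOneSpectrum (𝓞 K))) θ hθ hne1)]
  exact hunrineq

end Summit.BirchSwinnertonDyer.BirchSwinnertonDyer.Theorems.CharGrSelmerCorankGeOfFacts

end
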